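import Literature.AnabelianGeometry.SemiGraphs.TreeSystemFixedPoint
import Literature.AnabelianGeometry.SemiGraphs.TreeFixedSubjointSystemKill
import HarnessLib

/-!
# Compatible fixed subjoint systems by Kőnig selection over a fixed base subjoint ([SemiAnbd] Thm. 3.7 (iii), p. 41)

Mochizuki, *Semi-graphs of anabelioids*, Publ. RIMS **42** (2006), §3, Theorem 3.7 (iii), author's
manuscript p. 41, third paragraph of the proof, with the author's *Comments* (2020), item (6)(b):
"Since the semi-graphs `𝔾_j` are all finite, we thus conclude that we may choose a compatible system
of such subjoints [i.e., on which `H` acts trivially]" — the COMPATIBILITY step is a Kőnig /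
compactness selection from level-wise FINITE nonempty sets of `H`-fixed subjoints. [cite:
MochizukiSemiAnbd2006, Thm. 3.7(iii) p.41]

PROOF-ONLY, GENERIC tool file (cell abc-iut, layer L3, GAP row G-t6g3-2b «Thm 3.7 (iii)/Cor 3.9
beyond finite 𝒢», shared sub-row **G2·GEN-ENDS** of L3-lead ruling α38 (3); seat abc-iut-w5-d189; no
definition, no named fact, nothing specific to anabelioids).  In the `(T, f, ρ)` tree-system
currency of `TreeSystemBoundedGeodesics.lean` (abc-iut-w5-d160) — trees `T j` over a directed order,
FUNCTORIAL transition morphisms `f : T j ⟶ T i` (`i ≤ j`), equivariant actions `ρ j : P →* Aut (T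
j)`, a subgroup `C ≤ P` — and, for the "over a base" statements, structure morphisms `π j : T j ⟶ B`
to one base semi-graph `B` with `f ≫ π i = π j` (the fields `trans_id`, `trans_comp`, `trans_act`,
`trans_over` of `VerticialLevelData`):

* `SemiGraph.exists_fixedSubjointSystem_of_finite_family` — **Kőnig for subjoints**: a family `A j`
  of `C`-fixed subjoints `(w; β ≠ β')` of `T j` (two distinct branches abutting to a vertex, all
  three fixed by `C`) which is nonempty, FINITE and STABLE under the transition maps (the image
  triple is again a member — in particular again non-degenerate) contains a compatible `C`-fixed
  subjoint system indexed by ALL levels (abc-iut-L3-t6's `exists_compatible_of_finite` on the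
  product type; the vertex analogue is abc-iut-w4-d080's
  `VerticialLevelData.hfix_of_finite_fixed_family`);
* `SemiGraph.branchMap_ne_of_over` — **no folding over distinct base branches**: two branches of `T
  j` with distinct images in `B` have distinct images in `T i`; so the `C`-fixed subjoints lying
  over ONE base subjoint `(u; b ≠ b')` of `B` form a trans-stable family for free
  (`SemiGraph.mapsTo_fixedSubjointsOver`);
* `SemiGraph.exists_fixedSubjointSystem_over` — hence: if at EVERY level some `C`-fixed subjoint
  lies over `(u; b, b')`, and at every level the `C`-fixed vertices over `u` and the branches over
  `b`, `b'` at each of them are FINITE, there is a compatible `C`-fixed subjoint system over `(u; b,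
  b')`; `…_of_cofinal` (nonemptiness on a cofinal set of levels suffices) and `…_eventually`
  (hypotheses above a level `j₀`, conclusion over `{i // j₀ ≤ i}` in the exact binder shape `(m, δ,
  δ', hpair, hcompat, hfix)` of abc-iut-L3-t10's kill `SemiGraph.eq_bot_of_fixedSubjointSystem`);
* `SemiGraph.eq_bot_of_fixedSubjoints_over` — the composed **kill**: under the estrangement input
  `hnobp` of `TreeFixedSubjointSystemKill.lean`, cofinally-nonempty finite families of `C`-fixed
  subjoints over one non-degenerate base subjoint force `C = ⊥`;
* edge currency (fixed EDGE-pairs over a base edge-pair `(u; e ≠ e')`, the shape produced by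
  `C`-fixed lifted paths through `u` over two distinct base edges): sequel file
  `TreeSystemEdgePairSelection.lean`.

HONEST LIMIT (abc-iut-L3-t10, SHAPES-Ggt6g32 §(f) v3): under a genuine ESCAPE of the fixed loci no
family over a fixed base cell is cofinally nonempty, so these selections serve the NON-escaping
branches of G-t6g3-2b (vertical growth with finite fixed fibres) only; nothing here asserts the
fixed-systems input (FIX∞) for an infinite `𝔾`, and nothing bears on [IUTchIII] Cor. 3.12.  TEST
(abc-iut-w4-d075's `𝒢⋆`): finite trees, so every finiteness hypothesis holds and nothing false is
asserted.-/

namespace Literature.AnabelianGeometry.SemiGraphs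

namespace SemiGraph

open CategoryTheory

universe w v u

section Family

variable {P : Type w} [Group P] (C : Subgroup P) {J : Type v} [Preorder J]
  (T : J → SemiGraph.{u}) (ρ : ∀ j, P →* Aut (T j)) (f : ∀ ⦃i j : J⦄, i ≤ j → (T j ⟶ T i))

/-- **Kőnig for fixed subjoints** ([SemiAnbd] p. 41 "we may choose a compatible system of such
subjoints"): over a directed order of levels with FUNCTORIAL transition morphisms, a family `A j` of
`C`-fixed subjoints of `T j` — triples `(w; β, β')` with `β ≠ β'` both abutting to `w` and `w`, `β`, `β'`
fixed by every element of `C` — that is nonempty, FINITE and mapped into itself by the transition maps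
contains a compatible `C`-fixed subjoint system `(m j; δ j, δ' j)_{j ∈ J}` with `(m j, δ j, δ' j) ∈ A j`.
[cite: MochizukiSemiAnbd2006, Thm. 3.7(iii) p.41] -/
theorem exists_fixedSubjointSystem_of_finite_family [IsDirectedOrder J]
    (hid : ∀ j, f (le_refl j) = 𝟙 (T j))
    (hcomp : ∀ ⦃i j k : J⦄ (hij : i ≤ j) (hjk : j ≤ k), f hjk ≫ f hij = f (hij.trans hjk))
    (A : ∀ j, Set ((T j).Vertex × (T j).Branch × (T j).Branch))
    (hA : ∀ j, ∀ p ∈ A j, p.2.1 ≠ p.2.2 ∧ (T j).abuts p.2.1 = some p.1 ∧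
      (T j).abuts p.2.2 = some p.1 ∧ ∀ γ : C, (ρ j γ).hom.vertexMap p.1 = p.1 ∧ (ρ j γ).hom.branchMap p.2.1 = p.2.1 ∧
        (ρ j γ).hom.branchMap p.2.2 = p.2.2)
    (hne : ∀ j, (A j).Nonempty) (hfin : ∀ j, (A j).Finite)
    (hmap : ∀ ⦃i j : J⦄ (h : i ≤ j), ∀ p ∈ A j,
      ((f h).vertexMap p.1, (f h).branchMap p.2.1, (f h).branchMap p.2.2) ∈ A i) :
    ∃ (m : ∀ j, (T j).Vertex) (δ δ' : ∀ j, (T j).Branch),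
      (∀ j, (m j, δ j, δ' j) ∈ A j) ∧
      (∀ j, δ j ≠ δ' j ∧ (T j).abuts (δ j) = some (m j) ∧ (T j).abuts (δ' j) = some (m j)) ∧
      (∀ ⦃i j : J⦄ (h : i ≤ j), (f h).vertexMap (m j) = m i ∧
        (f h).branchMap (δ j) = δ i ∧ (f h).branchMap (δ' j) = δ' i) ∧
      (∀ (j : J) (γ : C), (ρ j γ).hom.vertexMap (m j) = m j ∧
        (ρ j γ).hom.branchMap (δ j) = δ j ∧ (ρ j γ).hom.branchMap (δ' j) = δ' j) := by
  -- the transition maps on triples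
  let F : ∀ ⦃i j : J⦄, i ≤ j → (T j).Vertex × (T j).Branch × (T j).Branch →
      (T i).Vertex × (T i).Branch × (T i).Branch :=
    fun i j h p => ((f h).vertexMap p.1, (f h).branchMap p.2.1, (f h).branchMap p.2.2)
  have F_id : ∀ (j : J) (p : (T j).Vertex × (T j).Branch × (T j).Branch), F le_rfl p = p := by
    intro j p
    have h1 := hid j
    show ((f (le_refl j)).vertexMap p.1, (f (le_refl j)).branchMap p.2.1,
      (f (le_refl j)).branchMap p.2.2) = p
    rw [h1]
    rfl
  have F_comp : ∀ ⦃i j k : J⦄ (hij : i ≤ j) (hjk : j ≤ k)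
      (p : (T k).Vertex × (T k).Branch × (T k).Branch), F hij (F hjk p) = F (hij.trans hjk) p := by
    intro i j k hij hjk p
    have h1 := hcomp hij hjk
    show ((f hij).vertexMap ((f hjk).vertexMap p.1), (f hij).branchMap ((f hjk).branchMap p.2.1),
      (f hij).branchMap ((f hjk).branchMap p.2.2)) =
      ((f (hij.trans hjk)).vertexMap p.1, (f (hij.trans hjk)).branchMap p.2.1,
        (f (hij.trans hjk)).branchMap p.2.2)
    rw [← h1]
    rfl
  obtain ⟨x, hxA, hxc⟩ := exists_compatible_of_finite F F_id F_comp A hfin hne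
    (fun i j h p hp => hmap h p hp)
  refine ⟨fun j => (x j).1, fun j => (x j).2.1, fun j => (x j).2.2, fun j => hxA j,
    fun j => ⟨(hA j _ (hxA j)).1, (hA j _ (hxA j)).2.1, (hA j _ (hxA j)).2.2.1⟩,
    fun i j h => ?_, fun j γ => (hA j _ (hxA j)).2.2.2 γ⟩
  have hc := hxc h
  exact ⟨congrArg Prod.fst hc, congrArg (fun p => p.2.1) hc, congrArg (fun p => p.2.2) hc⟩

end Family

/-! ### Over a base semi-graph: no folding over distinct base branches -/

section Over

variable {P : Type w} [Group P] (C : Subgroup P) {J : Type v} [Preorder J]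
  (T : J → SemiGraph.{u}) (ρ : ∀ j, P →* Aut (T j)) (f : ∀ ⦃i j : J⦄, i ≤ j → (T j ⟶ T i))
  {B : SemiGraph.{u}} (π : ∀ j, T j ⟶ B)

/-- The transition maps are over the base on vertices: `π i (f h w) = π j w`.
[cite: MochizukiSemiAnbd2006, Thm. 3.7(iii) p.41] -/
theorem vertexMap_over (hover : ∀ ⦃i j : J⦄ (h : i ≤ j), f h ≫ π i = π j) ⦃i j : J⦄ (h : i ≤ j)
    (w : (T j).Vertex) : (π i).vertexMap ((f h).vertexMap w) = (π j).vertexMap w := by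
  have e := congrArg (fun φ : T j ⟶ B => φ.vertexMap w) (hover h)
  simpa only [comp_vertexMap, Function.comp_apply] using e

/-- The transition maps are over the base on branches: `π i (f h β) = π j β`.
[cite: MochizukiSemiAnbd2006, Thm. 3.7(iii) p.41] -/
theorem branchMap_over (hover : ∀ ⦃i j : J⦄ (h : i ≤ j), f h ≫ π i = π j) ⦃i j : J⦄ (h : i ≤ j)
    (β : (T j).Branch) : (π i).branchMap ((f h).branchMap β) = (π j).branchMap β := by
  have e := congrArg (fun φ : T j ⟶ B => φ.branchMap β) (hover h)
  simpa only [comp_branchMap, Function.comp_apply] using e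

/-- The transition maps are over the base on edges: `π i (f h ε) = π j ε`.
[cite: MochizukiSemiAnbd2006, Thm. 3.7(iii) p.41] -/
theorem edgeMap_over (hover : ∀ ⦃i j : J⦄ (h : i ≤ j), f h ≫ π i = π j) ⦃i j : J⦄ (h : i ≤ j)
    (ε : (T j).Edge) : (π i).edgeMap ((f h).edgeMap ε) = (π j).edgeMap ε := by
  have e := congrArg (fun φ : T j ⟶ B => φ.edgeMap ε) (hover h)
  simpa only [comp_edgeMap, Function.comp_apply] using e

/-- **No folding over distinct base branches**: two branches of `T j` lying over DISTINCT branches of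
the base have distinct images under every transition map (the transition maps are over the base).  In
particular a subjoint of `T j` over a non-degenerate base subjoint is never collapsed.
[cite: MochizukiSemiAnbd2006, Thm. 3.7(iii) p.41] -/
theorem branchMap_ne_of_over (hover : ∀ ⦃i j : J⦄ (h : i ≤ j), f h ≫ π i = π j) ⦃i j : J⦄
    (h : i ≤ j) {β β' : (T j).Branch} (hne : (π j).branchMap β ≠ (π j).branchMap β') :
    (f h).branchMap β ≠ (f h).branchMap β' := by
  intro heq
  apply hne
  rw [← branchMap_over T f π hover h β, ← branchMap_over T f π hover h β', heq]

/-- Equivariance of the transition maps on vertices, pointwise.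
[cite: MochizukiSemiAnbd2006, Thm. 3.7(iii) p.41] -/
theorem vertexMap_equiv
    (hequiv : ∀ ⦃i j : J⦄ (h : i ≤ j) (g : P), (ρ j g).hom ≫ f h = f h ≫ (ρ i g).hom)
    ⦃i j : J⦄ (h : i ≤ j) (g : P) (w : (T j).Vertex) :
    (ρ i g).hom.vertexMap ((f h).vertexMap w) = (f h).vertexMap ((ρ j g).hom.vertexMap w) := by
  have e := congrArg (fun φ : T j ⟶ T i => φ.vertexMap w) (hequiv h g)
  simp only [comp_vertexMap, Function.comp_apply] at e
  exact e.symm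

/-- Equivariance of the transition maps on branches, pointwise.
[cite: MochizukiSemiAnbd2006, Thm. 3.7(iii) p.41] -/
theorem branchMap_equiv
    (hequiv : ∀ ⦃i j : J⦄ (h : i ≤ j) (g : P), (ρ j g).hom ≫ f h = f h ≫ (ρ i g).hom)
    ⦃i j : J⦄ (h : i ≤ j) (g : P) (β : (T j).Branch) :
    (ρ i g).hom.branchMap ((f h).branchMap β) = (f h).branchMap ((ρ j g).hom.branchMap β) := by
  have e := congrArg (fun φ : T j ⟶ T i => φ.branchMap β) (hequiv h g)
  simp only [comp_branchMap, Function.comp_apply] at e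
  exact e.symm

/-- **The `C`-fixed subjoints over one base subjoint form a trans-stable family.**  For a base vertex
`u` and base branches `b ≠ b'`, the set of triples `(w; β, β')` of `T j` with `π w = u`, `π β = b`,
`π β' = b'`, `β`, `β'` abutting to `w`, all fixed by `C`, is mapped by every transition map into the
corresponding set of `T i` (over the base + equivariance), and its members are subjoints (`β ≠ β'` by
`b ≠ b'`). [cite: MochizukiSemiAnbd2006, Thm. 3.7(iii) p.41] -/
theorem mapsTo_fixedSubjointsOver (hover : ∀ ⦃i j : J⦄ (h : i ≤ j), f h ≫ π i = π j)
    (hequiv : ∀ ⦃i j : J⦄ (h : i ≤ j) (g : P), (ρ j g).hom ≫ f h = f h ≫ (ρ i g).hom)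
    (u : B.Vertex) (b b' : B.Branch) ⦃i j : J⦄ (h : i ≤ j)
    (p : (T j).Vertex × (T j).Branch × (T j).Branch)
    (hp : (π j).vertexMap p.1 = u ∧ (π j).branchMap p.2.1 = b ∧ (π j).branchMap p.2.2 = b' ∧
      (T j).abuts p.2.1 = some p.1 ∧ (T j).abuts p.2.2 = some p.1 ∧
      ∀ γ : C, (ρ j γ).hom.vertexMap p.1 = p.1 ∧ (ρ j γ).hom.branchMap p.2.1 = p.2.1 ∧
        (ρ j γ).hom.branchMap p.2.2 = p.2.2) :
    (π i).vertexMap ((f h).vertexMap p.1) = u ∧ (π i).branchMap ((f h).branchMap p.2.1) = b ∧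
      (π i).branchMap ((f h).branchMap p.2.2) = b' ∧
      (T i).abuts ((f h).branchMap p.2.1) = some ((f h).vertexMap p.1) ∧
      (T i).abuts ((f h).branchMap p.2.2) = some ((f h).vertexMap p.1) ∧
      ∀ γ : C, (ρ i γ).hom.vertexMap ((f h).vertexMap p.1) = (f h).vertexMap p.1 ∧
        (ρ i γ).hom.branchMap ((f h).branchMap p.2.1) = (f h).branchMap p.2.1 ∧
        (ρ i γ).hom.branchMap ((f h).branchMap p.2.2) = (f h).branchMap p.2.2 := by
  obtain ⟨hu, hb, hb', ha, ha', hfix⟩ := hp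
  refine ⟨by rw [vertexMap_over T f π hover h, hu], by rw [branchMap_over T f π hover h, hb],
    by rw [branchMap_over T f π hover h, hb'], (f h).abuts_branchMap _ _ ha,
    (f h).abuts_branchMap _ _ ha', fun γ => ⟨?_, ?_, ?_⟩⟩
  · rw [vertexMap_equiv T ρ f hequiv h, (hfix γ).1]
  · rw [branchMap_equiv T ρ f hequiv h, (hfix γ).2.1]
  · rw [branchMap_equiv T ρ f hequiv h, (hfix γ).2.2]


/-! ### Kőnig selection of compatible fixed subjoints over a fixed base subjoint -/

/-- **Compatible `C`-fixed subjoint system over a fixed base subjoint.**  Let `b ≠ b'` be base branches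
and `u` a base vertex.  If at EVERY level `j` some `C`-fixed subjoint `(w; β, β')` of `T j` lies over
`(u; b, b')` (`π w = u`, `π β = b`, `π β' = b'`), and at every level the `C`-fixed vertices of `T j` over
`u` are FINITE and each vertex of `T j` carries only finitely many branches over `b` or `b'`, then there
is a COMPATIBLE `C`-fixed subjoint system `(m j; δ j, δ' j)_{j ∈ J}` over `(u; b, b')` — Kőnig selection
(`exists_fixedSubjointSystem_of_finite_family`) in the trans-stable family `mapsTo_fixedSubjointsOver`;
no folding because `b ≠ b'` (`branchMap_ne_of_over`). [cite: MochizukiSemiAnbd2006, Thm. 3.7(iii) p.41] -/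
theorem exists_fixedSubjointSystem_over [IsDirectedOrder J]
    (hid : ∀ j, f (le_refl j) = 𝟙 (T j))
    (hcomp : ∀ ⦃i j k : J⦄ (hij : i ≤ j) (hjk : j ≤ k), f hjk ≫ f hij = f (hij.trans hjk))
    (hover : ∀ ⦃i j : J⦄ (h : i ≤ j), f h ≫ π i = π j)
    (hequiv : ∀ ⦃i j : J⦄ (h : i ≤ j) (g : P), (ρ j g).hom ≫ f h = f h ≫ (ρ i g).hom)
    (u : B.Vertex) (b b' : B.Branch) (hbb' : b ≠ b')
    (hne : ∀ j, ∃ (w : (T j).Vertex) (β β' : (T j).Branch), (π j).vertexMap w = u ∧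
      (π j).branchMap β = b ∧ (π j).branchMap β' = b' ∧
      (T j).abuts β = some w ∧ (T j).abuts β' = some w ∧
      ∀ γ : C, (ρ j γ).hom.vertexMap w = w ∧ (ρ j γ).hom.branchMap β = β ∧
        (ρ j γ).hom.branchMap β' = β')
    (hfinV : ∀ j, {w : (T j).Vertex | (π j).vertexMap w = u ∧
      ∀ γ : C, (ρ j γ).hom.vertexMap w = w}.Finite)
    (hfinB : ∀ (j : J) (w : (T j).Vertex), {β : (T j).Branch | (T j).abuts β = some w ∧
      ((π j).branchMap β = b ∨ (π j).branchMap β = b')}.Finite) :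
    ∃ (m : ∀ j, (T j).Vertex) (δ δ' : ∀ j, (T j).Branch),
      (∀ j, (π j).vertexMap (m j) = u ∧ (π j).branchMap (δ j) = b ∧ (π j).branchMap (δ' j) = b') ∧
      (∀ j, δ j ≠ δ' j ∧ (T j).abuts (δ j) = some (m j) ∧ (T j).abuts (δ' j) = some (m j)) ∧
      (∀ ⦃i j : J⦄ (h : i ≤ j), (f h).vertexMap (m j) = m i ∧
        (f h).branchMap (δ j) = δ i ∧ (f h).branchMap (δ' j) = δ' i) ∧
      (∀ (j : J) (γ : C), (ρ j γ).hom.vertexMap (m j) = m j ∧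
        (ρ j γ).hom.branchMap (δ j) = δ j ∧ (ρ j γ).hom.branchMap (δ' j) = δ' j) := by
  -- the family of `C`-fixed subjoints over `(u; b, b')`
  let A : ∀ j, Set ((T j).Vertex × (T j).Branch × (T j).Branch) := fun j =>
    {p | (π j).vertexMap p.1 = u ∧ (π j).branchMap p.2.1 = b ∧ (π j).branchMap p.2.2 = b' ∧
      (T j).abuts p.2.1 = some p.1 ∧ (T j).abuts p.2.2 = some p.1 ∧
      ∀ γ : C, (ρ j γ).hom.vertexMap p.1 = p.1 ∧ (ρ j γ).hom.branchMap p.2.1 = p.2.1 ∧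
        (ρ j γ).hom.branchMap p.2.2 = p.2.2}
  have hA : ∀ j, ∀ p ∈ A j, p.2.1 ≠ p.2.2 ∧ (T j).abuts p.2.1 = some p.1 ∧
      (T j).abuts p.2.2 = some p.1 ∧ ∀ γ : C, (ρ j γ).hom.vertexMap p.1 = p.1 ∧
        (ρ j γ).hom.branchMap p.2.1 = p.2.1 ∧ (ρ j γ).hom.branchMap p.2.2 = p.2.2 := by
    rintro j p ⟨-, hb, hb', ha, ha', hfix⟩
    refine ⟨fun heq => hbb' ?_, ha, ha', hfix⟩
    rw [← hb, ← hb', heq]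
  have hAne : ∀ j, (A j).Nonempty := by
    intro j
    obtain ⟨w, β, β', hw, hβ, hβ', ha, ha', hfix⟩ := hne j
    exact ⟨(w, β, β'), hw, hβ, hβ', ha, ha', hfix⟩
  have hAfin : ∀ j, (A j).Finite := by
    intro j
    -- `A j ⊆ V × W × W` with `V` the fixed vertices over `u`, `W` the branches over `b`, `b'` at them
    let V : Set (T j).Vertex := {w | (π j).vertexMap w = u ∧ ∀ γ : C, (ρ j γ).hom.vertexMap w = w}
    let W : Set (T j).Branch := ⋃ w ∈ V, {β : (T j).Branch | (T j).abuts β = some w ∧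
      ((π j).branchMap β = b ∨ (π j).branchMap β = b')}
    have hV : V.Finite := hfinV j
    have hW : W.Finite := hV.biUnion fun w _ => hfinB j w
    refine (hV.prod (hW.prod hW)).subset ?_
    rintro ⟨w, β, β'⟩ ⟨hw, hβ, hβ', ha, ha', hfix⟩
    have hwV : w ∈ V := ⟨hw, fun γ => (hfix γ).1⟩
    refine ⟨hwV, ?_, ?_⟩
    · exact Set.mem_biUnion hwV ⟨ha, Or.inl hβ⟩
    · exact Set.mem_biUnion hwV ⟨ha', Or.inr hβ'⟩
  have hAmap : ∀ ⦃i j : J⦄ (h : i ≤ j), ∀ p ∈ A j,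
      ((f h).vertexMap p.1, (f h).branchMap p.2.1, (f h).branchMap p.2.2) ∈ A i :=
    fun i j h p hp => mapsTo_fixedSubjointsOver C T ρ f π hover hequiv u b b' h p hp
  obtain ⟨m, δ, δ', hmem, hpair, hcompat, hfix⟩ :=
    exists_fixedSubjointSystem_of_finite_family C T ρ f hid hcomp A hA hAne hAfin hAmap
  exact ⟨m, δ, δ', fun j => ⟨(hmem j).1, (hmem j).2.1, (hmem j).2.2.1⟩, hpair, hcompat, hfix⟩

/-- **Cofinal nonemptiness suffices**: in `exists_fixedSubjointSystem_over` it is enough that a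
`C`-fixed subjoint over `(u; b, b')` exists at a COFINAL set of levels (for every `i` at some `j ≥ i`) —
its images under the transition maps supply the other levels.
[cite: MochizukiSemiAnbd2006, Thm. 3.7(iii) p.41] -/
theorem exists_fixedSubjointSystem_over_of_cofinal [IsDirectedOrder J]
    (hid : ∀ j, f (le_refl j) = 𝟙 (T j))
    (hcomp : ∀ ⦃i j k : J⦄ (hij : i ≤ j) (hjk : j ≤ k), f hjk ≫ f hij = f (hij.trans hjk))
    (hover : ∀ ⦃i j : J⦄ (h : i ≤ j), f h ≫ π i = π j)
    (hequiv : ∀ ⦃i j : J⦄ (h : i ≤ j) (g : P), (ρ j g).hom ≫ f h = f h ≫ (ρ i g).hom)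
    (u : B.Vertex) (b b' : B.Branch) (hbb' : b ≠ b')
    (hcof : ∀ i, ∃ j, i ≤ j ∧ ∃ (w : (T j).Vertex) (β β' : (T j).Branch), (π j).vertexMap w = u ∧
      (π j).branchMap β = b ∧ (π j).branchMap β' = b' ∧
      (T j).abuts β = some w ∧ (T j).abuts β' = some w ∧
      ∀ γ : C, (ρ j γ).hom.vertexMap w = w ∧ (ρ j γ).hom.branchMap β = β ∧
        (ρ j γ).hom.branchMap β' = β')
    (hfinV : ∀ j, {w : (T j).Vertex | (π j).vertexMap w = u ∧
      ∀ γ : C, (ρ j γ).hom.vertexMap w = w}.Finite)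
    (hfinB : ∀ (j : J) (w : (T j).Vertex), {β : (T j).Branch | (T j).abuts β = some w ∧
      ((π j).branchMap β = b ∨ (π j).branchMap β = b')}.Finite) :
    ∃ (m : ∀ j, (T j).Vertex) (δ δ' : ∀ j, (T j).Branch),
      (∀ j, (π j).vertexMap (m j) = u ∧ (π j).branchMap (δ j) = b ∧ (π j).branchMap (δ' j) = b') ∧
      (∀ j, δ j ≠ δ' j ∧ (T j).abuts (δ j) = some (m j) ∧ (T j).abuts (δ' j) = some (m j)) ∧
      (∀ ⦃i j : J⦄ (h : i ≤ j), (f h).vertexMap (m j) = m i ∧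
        (f h).branchMap (δ j) = δ i ∧ (f h).branchMap (δ' j) = δ' i) ∧
      (∀ (j : J) (γ : C), (ρ j γ).hom.vertexMap (m j) = m j ∧
        (ρ j γ).hom.branchMap (δ j) = δ j ∧ (ρ j γ).hom.branchMap (δ' j) = δ' j) := by
  refine exists_fixedSubjointSystem_over C T ρ f π hid hcomp hover hequiv u b b' hbb' ?_ hfinV hfinB
  intro i
  obtain ⟨j, hij, w, β, β', hp⟩ := hcof i
  have hq := mapsTo_fixedSubjointsOver C T ρ f π hover hequiv u b b' hij (w, β, β') hp
  exact ⟨(f hij).vertexMap w, (f hij).branchMap β, (f hij).branchMap β', hq⟩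

/-- Levels above `j₀` form a directed order. [cite: MochizukiSemiAnbd2006, Thm. 3.7(iii) p.41] -/
theorem isDirectedOrder_subtype_ge [IsDirectedOrder J] (j₀ : J) :
    IsDirectedOrder {j : J // j₀ ≤ j} := by
  refine ⟨fun a c => ?_⟩
  obtain ⟨d, had, hcd⟩ := exists_ge_ge a.1 c.1
  exact ⟨⟨d, a.2.trans had⟩, had, hcd⟩

/-- **Eventual form, in the binder shape of the estrangement kill.**  Hypotheses of
`exists_fixedSubjointSystem_over` at the levels `j ≥ j₀` only ("by possibly replacing `J` by some smaller
cofinal subset", p. 41) give a compatible `C`-fixed subjoint system `(m i; δ i, δ' i)` indexed by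
`{i // j₀ ≤ i}` over `(u; b, b')` — exactly the data `(m, δ, δ', hpair, hcompat, hfix)` consumed by
abc-iut-L3-t10's `SemiGraph.eq_bot_of_fixedSubjointSystem`. [cite: MochizukiSemiAnbd2006, Thm. 3.7(iii) p.41] -/
theorem exists_fixedSubjointSystem_over_eventually [IsDirectedOrder J]
    (hid : ∀ j, f (le_refl j) = 𝟙 (T j))
    (hcomp : ∀ ⦃i j k : J⦄ (hij : i ≤ j) (hjk : j ≤ k), f hjk ≫ f hij = f (hij.trans hjk))
    (hover : ∀ ⦃i j : J⦄ (h : i ≤ j), f h ≫ π i = π j)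
    (hequiv : ∀ ⦃i j : J⦄ (h : i ≤ j) (g : P), (ρ j g).hom ≫ f h = f h ≫ (ρ i g).hom)
    (u : B.Vertex) (b b' : B.Branch) (hbb' : b ≠ b') (j₀ : J)
    (hne : ∀ j, j₀ ≤ j → ∃ (w : (T j).Vertex) (β β' : (T j).Branch), (π j).vertexMap w = u ∧
      (π j).branchMap β = b ∧ (π j).branchMap β' = b' ∧
      (T j).abuts β = some w ∧ (T j).abuts β' = some w ∧
      ∀ γ : C, (ρ j γ).hom.vertexMap w = w ∧ (ρ j γ).hom.branchMap β = β ∧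
        (ρ j γ).hom.branchMap β' = β')
    (hfinV : ∀ j, j₀ ≤ j → {w : (T j).Vertex | (π j).vertexMap w = u ∧
      ∀ γ : C, (ρ j γ).hom.vertexMap w = w}.Finite)
    (hfinB : ∀ j, j₀ ≤ j → ∀ w : (T j).Vertex, {β : (T j).Branch | (T j).abuts β = some w ∧
      ((π j).branchMap β = b ∨ (π j).branchMap β = b')}.Finite) :
    ∃ (m : ∀ i : {i : J // j₀ ≤ i}, (T i.1).Vertex)
      (δ δ' : ∀ i : {i : J // j₀ ≤ i}, (T i.1).Branch),
      (∀ i, (π i.1).vertexMap (m i) = u ∧ (π i.1).branchMap (δ i) = b ∧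
        (π i.1).branchMap (δ' i) = b') ∧
      (∀ i, δ i ≠ δ' i ∧ (T i.1).abuts (δ i) = some (m i) ∧ (T i.1).abuts (δ' i) = some (m i)) ∧
      (∀ ⦃i i' : {i : J // j₀ ≤ i}⦄ (h : i.1 ≤ i'.1), (f h).vertexMap (m i') = m i ∧
        (f h).branchMap (δ i') = δ i ∧ (f h).branchMap (δ' i') = δ' i) ∧
      (∀ (i : {i : J // j₀ ≤ i}) (γ : C), (ρ i.1 γ).hom.vertexMap (m i) = m i ∧
        (ρ i.1 γ).hom.branchMap (δ i) = δ i ∧ (ρ i.1 γ).hom.branchMap (δ' i) = δ' i) := by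
  haveI : IsDirectedOrder {j : J // j₀ ≤ j} := isDirectedOrder_subtype_ge j₀
  obtain ⟨m, δ, δ', hover', hpair, hcompat, hfix⟩ :=
    exists_fixedSubjointSystem_over (J := {j : J // j₀ ≤ j}) C (fun i => T i.1) (fun i => ρ i.1)
      (fun i i' (h : i ≤ i') => f (show i.1 ≤ i'.1 from h)) (fun i => π i.1)
      (fun i => hid i.1) (fun i i' k hii' hi'k => hcomp _ _) (fun i i' h => hover _)
      (fun i i' h g => hequiv _ g) u b b' hbb' (fun i => hne i.1 i.2) (fun i => hfinV i.1 i.2)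
      (fun i => hfinB i.1 i.2)
  exact ⟨m, δ, δ', hover', hpair, fun i i' h => hcompat (show i ≤ i' from h), hfix⟩

/-- **The composed kill** ([SemiAnbd] p. 41, third paragraph, with Comments (6)(b)): in the situation
of abc-iut-L3-t10's `SemiGraph.eq_bot_of_fixedSubjointSystem` (trees `T j` with `C`-actions, levels `G j`
with equivariant immersions `q j : T j ⟶ G j` compatible with the transitions, and the estrangement input
`hnobp` on the levels), if above some level `j₀` there is at every level a `C`-fixed subjoint of `T j`
over ONE non-degenerate base subjoint `(u; b ≠ b')`, with finite `C`-fixed vertex fibres over `u` and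
finitely many branches over `b`, `b'` at each vertex, then `C = ⊥`.
[cite: MochizukiSemiAnbd2006, Thm. 3.7(iii) p.41] -/
theorem eq_bot_of_fixedSubjoints_over [IsDirectedOrder J]
    (hid : ∀ j, f (le_refl j) = 𝟙 (T j))
    (hcomp : ∀ ⦃i j k : J⦄ (hij : i ≤ j) (hjk : j ≤ k), f hjk ≫ f hij = f (hij.trans hjk))
    (hover : ∀ ⦃i j : J⦄ (h : i ≤ j), f h ≫ π i = π j)
    (hequiv : ∀ ⦃i j : J⦄ (h : i ≤ j) (g : P), (ρ j g).hom ≫ f h = f h ≫ (ρ i g).hom)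
    (G : J → SemiGraph.{u}) (τ : ∀ j, P →* Aut (G j)) (q : ∀ j, T j ⟶ G j)
    (hq : ∀ j, IsImmersion (q j)) (hqe : ∀ (j : J) (g : P), (ρ j g).hom ≫ q j = q j ≫ (τ j g).hom)
    (gf : ∀ ⦃i j : J⦄, i ≤ j → (G j ⟶ G i)) (hsq : ∀ ⦃i j : J⦄ (h : i ≤ j), f h ≫ q i = q j ≫ gf h)
    (hnobp : ∀ (j₀ : J) (w : ∀ i : {i : J // j₀ ≤ i}, (G i.1).Vertex)
      (β β' : ∀ i : {i : J // j₀ ≤ i}, (G i.1).Branch),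
      (∀ i, β i ≠ β' i ∧ (G i.1).abuts (β i) = some (w i) ∧ (G i.1).abuts (β' i) = some (w i)) →
      (∀ ⦃i i' : {i : J // j₀ ≤ i}⦄ (h : i.1 ≤ i'.1), (gf h).vertexMap (w i') = w i ∧
        (gf h).branchMap (β i') = β i ∧ (gf h).branchMap (β' i') = β' i) →
      (∀ (i : {i : J // j₀ ≤ i}) (γ : C), (τ i.1 γ).hom.vertexMap (w i) = w i ∧
        (τ i.1 γ).hom.branchMap (β i) = β i ∧ (τ i.1 γ).hom.branchMap (β' i) = β' i) → C = ⊥)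
    (u : B.Vertex) (b b' : B.Branch) (hbb' : b ≠ b') (j₀ : J)
    (hne : ∀ j, j₀ ≤ j → ∃ (w : (T j).Vertex) (β β' : (T j).Branch), (π j).vertexMap w = u ∧
      (π j).branchMap β = b ∧ (π j).branchMap β' = b' ∧
      (T j).abuts β = some w ∧ (T j).abuts β' = some w ∧
      ∀ γ : C, (ρ j γ).hom.vertexMap w = w ∧ (ρ j γ).hom.branchMap β = β ∧
        (ρ j γ).hom.branchMap β' = β')
    (hfinV : ∀ j, j₀ ≤ j → {w : (T j).Vertex | (π j).vertexMap w = u ∧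
      ∀ γ : C, (ρ j γ).hom.vertexMap w = w}.Finite)
    (hfinB : ∀ j, j₀ ≤ j → ∀ w : (T j).Vertex, {β : (T j).Branch | (T j).abuts β = some w ∧
      ((π j).branchMap β = b ∨ (π j).branchMap β = b')}.Finite) :
    C = ⊥ := by
  obtain ⟨m, δ, δ', -, hpair, hcompat, hfix⟩ :=
    exists_fixedSubjointSystem_over_eventually C T ρ f π hid hcomp hover hequiv u b b' hbb' j₀ hne
      hfinV hfinB
  exact eq_bot_of_fixedSubjointSystem C T ρ f G τ q hq hqe gf hsq hnobp j₀ m δ δ' hpair hcompat hfix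

end Over

end SemiGraph

end Literature.AnabelianGeometry.SemiGraphs
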